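import Literature.AlgebraicGeometry.Resolution.PthRootGeneratorsValuation
import Literature.AlgebraicGeometry.Resolution.RsopMonomialIdeals
import Literature.AlgebraicGeometry.Resolution.RegularLocalRingsNormal
import HarnessLib

/-!
# A log-clean radicand is not a `p`-th power modulo an uncharged boundary parameter

Topic: `Literature/AlgebraicGeometry/Resolution` (Kummer bookkeeping for purely inseparable
extensions of degree `p` in characteristic `p`). Let `A` be a regular local ring of
characteristic `p` with regular system of parameters `u₁, …, u_d`, and let
`g = w · ∏ᵢ uᵢ^{aᵢ}` be a LOG-CLEAN radicand: `w` a unit, each exponent `aᵢ` either `0` or prime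
to `p`, and, when all `aᵢ = 0`, the REG clause — `w` is *wound* (`w - z^p ∉ 𝔪` for all `z`) or
*transversal to the boundary* (`w - z^p ∈ 𝔪 ∖ (𝔪² + (uᵢ : i ∈ Lab))` for some `z`), `Lab` a set
of boundary indices. If the boundary parameter `u_ℓ` (`ℓ ∈ Lab`) is UNCHARGED (`a_ℓ = 0`), then

  `e^p · g - c^p ∉ (u_ℓ)` for all `c ∈ A`, `e ∈ A ∖ (u_ℓ)`

(`residue_not_pth_power`): the image of `g` in the discrete valuation ring `A_{(u_ℓ)}` has a
residue which is not a `p`-th power. This is the input "NP" of the charge-invariance lemma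
(`PthRootChargeInvariance.lean`) at the generic point of the divisor `u_ℓ = 0`.

Proof. In the domain `B = A/(u_ℓ)`: if some `a_j ≠ 0` then `ū_j` is a prime element of `B`
(`A/(u_ℓ, u_j)` is a domain) not dividing the other `ūᵢ`, and comparing `ū_j`-adic orders in
`ē^p w̄ ∏ ūᵢ^{aᵢ} = c̄^p` gives `p ∣ a_j`; if all `aᵢ = 0` then `B` is regular, hence integrally
closed, so `ē^p w̄ = c̄^p` forces `ē ∣ c̄` and `w̄ = z̄^p`, i.e. `w ≡ z^p (mod u_ℓ)`, contradicting
woundness, and transversality too since then `w - z₀^p ≡ (z - z₀)^p ∈ 𝔪^p ⊆ 𝔪²` modulo `(u_ℓ)`.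

Also here: `prime_mk_of_isRsopPart` (a second member of a regular system of parameters stays prime
modulo the first).

## Sources

Folklore; the dichotomy hyperbolic/wound for `p`-th roots of monomials is in V. Cossart,
O. Piltant, J. Algebra 320 (2008) [CossartPiltant2008]. Regularity facts: H. Matsumura,
*Commutative Ring Theory* (1986), Thm. 14.2, 14.3, 19.4 [Matsumura1987] (tree files
`RsopMonomialIdeals.lean`, `RegularLocalRingsNormal.lean`).
-/

noncomputable section

open IsLocalRing

namespace Literature.AlgebraicGeometry.Resolution

/-! ## Comparing powers of a prime element -/

-- adapted from `Literature.NumberTheory.DiophantineGeometry.AlgFunctionField.pow_mul_eq_pow_mul_cancel`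
-- (`ArtinSchreierCurvePointCount.lean`; private copy to keep the imports of this file light)
/-- If `π` is a prime element of a domain and `π ∤ x`, `π ∤ y`, then `π^a x = π^b y` forces
`a = b`. [folklore] -/
private theorem eq_of_pow_mul_eq_pow_mul {R : Type*} [CommRing R] [IsDomain R] {π x y : R} (hπ : Prime π)
    (hx : ¬ π ∣ x) (hy : ¬ π ∣ y) {a b : ℕ} (h : π ^ a * x = π ^ b * y) : a = b :=
  (eq_and_dvd_sub_of_pow_succ_dvd_sub hπ hx hy (m := b) (by rw [h, sub_self]; exact dvd_zero _)).1

/-! ## A second parameter stays prime modulo the first -/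

/-- For `u, v` part of a regular system of parameters of `A`, the image of `v` in `A/(u)` is a
prime element (`A/(u, v)` is a regular local ring, hence a domain). [cite: Matsumura1987, Thm. 14.3] -/
theorem prime_mk_of_isRsopPart {A : Type*} [CommRing A] [IsLocalRing A] {u v : A}
    (h : IsRsopPart ![u, v]) : Prime (Ideal.Quotient.mk (Ideal.span {u}) v) := by
  haveI := h.isRegularLocalRing
  haveI := isDomain_of_isRegularLocalRing A
  set I : Ideal A := Ideal.span {u} with hI
  -- `(u, v)` is prime, so `(A/(u))/(v̄) ≅ A/(u, v)` is a domain
  have hrange : Set.range ![u, v] = {u, v} := by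
    ext x
    simp only [Set.mem_range, Set.mem_insert_iff, Set.mem_singleton_iff]
    constructor
    · rintro ⟨i, rfl⟩
      fin_cases i <;> simp
    · rintro (rfl | rfl)
      · exact ⟨0, rfl⟩
      · exact ⟨1, rfl⟩
  have hprime : (I ⊔ Ideal.span {v}).IsPrime := by
    have h1 := h.isPrime_span_range
    rw [hrange, Ideal.span_insert] at h1
    exact h1
  haveI : IsDomain (A ⧸ (I ⊔ Ideal.span {v})) := (Ideal.Quotient.isDomain_iff_prime _).mpr hprime
  haveI : IsDomain ((A ⧸ I) ⧸ (Ideal.span {v}).map (Ideal.Quotient.mk I)) :=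
    MulEquiv.isDomain (A ⧸ (I ⊔ Ideal.span {v})) (DoubleQuot.quotQuotEquivQuotSup I (Ideal.span {v})).toMulEquiv
  have hmap : (Ideal.span {v}).map (Ideal.Quotient.mk I) = Ideal.span {Ideal.Quotient.mk I v} := by
    rw [Ideal.map_span, Set.image_singleton]
  have hp : (Ideal.span {Ideal.Quotient.mk I v}).IsPrime := by
    rw [← hmap]
    exact (Ideal.Quotient.isDomain_iff_prime _).mp inferInstance
  have hne : Ideal.Quotient.mk I v ≠ 0 := by
    rw [Ne, Ideal.Quotient.eq_zero_iff_mem, hI, Ideal.mem_span_singleton]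
    exact h.not_dvd (i := 0) (j := 1) (by decide)
  exact (Ideal.span_singleton_prime hne).mp hp

/-! ## The theorem -/

/-- **A log-clean radicand is not a `p`-th power modulo an uncharged boundary parameter.** Let
`A` be a regular local ring of characteristic `p` (prime) with regular system of parameters
`u : Fin d → A` (`(u) = 𝔪`, `d = emb dim A`), `w ∈ Aˣ`, exponents `aᵢ` each `0` or prime to `p`,
`Lab` a set of (boundary) indices and `ℓ ∈ Lab` with `a_ℓ = 0`; assume the REG clause: if all
`aᵢ = 0` then `w - z^p ∉ 𝔪` for every `z` (wound), or `w - z^p ∈ 𝔪` and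
`w - z^p ∉ 𝔪² + (uᵢ : i ∈ Lab)` for some `z` (transversal). Then for all `c ∈ A` and
`e ∈ A ∖ (u_ℓ)`: `e^p · (w ∏ᵢ uᵢ^{aᵢ}) - c^p ∉ (u_ℓ)`. [folklore] -/
theorem residue_not_pth_power {A : Type*} [CommRing A] [IsRegularLocalRing A] (p : ℕ)
    (hp : p.Prime) [CharP A p] {d : ℕ} (u : Fin d → A)
    (hu : Ideal.span (Set.range u) = maximalIdeal A) (hd : (maximalIdeal A).spanFinrank = d)
    (a : Fin d → ℕ) (ha : ∀ i, a i = 0 ∨ ¬ p ∣ a i) (w : A) (hw : IsUnit w) (Lab : Set (Fin d))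
    (ℓ : Fin d) (hℓ : ℓ ∈ Lab) (haℓ : a ℓ = 0)
    (reg : (∀ i, a i = 0) → (∀ z : A, w - z ^ p ∉ maximalIdeal A) ∨
      (∃ z : A, w - z ^ p ∈ maximalIdeal A ∧
        w - z ^ p ∉ maximalIdeal A ^ 2 ⊔ Ideal.span (u '' Lab)))
    (c e : A) (he : e ∉ Ideal.span {u ℓ}) :
    e ^ p * (w * ∏ i, u i ^ a i) - c ^ p ∉ Ideal.span {u ℓ} := by
  classical
  haveI : Fact p.Prime := ⟨hp⟩
  haveI := isDomain_of_isRegularLocalRing A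
  intro hmem
  have hfull : IsRsopPart u := by
    have h := isRsopPart_comp_of_rsop hd u hu id Function.injective_id
    exact h
  have hone : IsRsopPart ![u ℓ] := by
    have h := isRsopPart_comp_of_rsop hd u hu ![ℓ] (fun i j _ => Subsingleton.elim i j)
    have heq : u ∘ ![ℓ] = ![u ℓ] := by ext i; fin_cases i; rfl
    rwa [heq] at h
  set I : Ideal A := Ideal.span {u ℓ} with hI
  haveI hIp : I.IsPrime := by
    rw [hI, Ideal.span_singleton_prime (show u ℓ ≠ 0 from hone.ne_zero 0)]
    exact (hone.prime 0 : Prime (u ℓ))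
  haveI : IsDomain (A ⧸ I) := (Ideal.Quotient.isDomain_iff_prime I).mpr hIp
  set mk := Ideal.Quotient.mk I with hmk
  have hIle : I ≤ maximalIdeal A := by
    rw [hI, Ideal.span_singleton_le_iff_mem, ← hu]
    exact Ideal.subset_span ⟨ℓ, rfl⟩
  -- the relation in `B = A/(u_ℓ)`
  have he0 : mk e ≠ 0 := by rwa [Ne, Ideal.Quotient.eq_zero_iff_mem]
  have hwu : IsUnit (mk w) := hw.map mk
  have hrel : mk e ^ p * (mk w * ∏ i, mk (u i) ^ a i) = mk c ^ p := by
    have h1 : mk (e ^ p * (w * ∏ i, u i ^ a i) - c ^ p) = 0 :=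
      (Ideal.Quotient.eq_zero_iff_mem).mpr hmem
    rw [map_sub, sub_eq_zero, map_mul, map_pow, map_mul, map_prod] at h1
    simp only [map_pow] at h1
    exact h1
  by_cases hch : ∃ j, a j ≠ 0
  · -- CASE 1: a charged coordinate `u_j`; compare `ū_j`-adic orders
    obtain ⟨j, hj⟩ := hch
    have hjℓ : j ≠ ℓ := fun h => hj (h ▸ haℓ)
    have hpa : ¬ p ∣ a j := (ha j).resolve_left hj
    have htwo : IsRsopPart ![u ℓ, u j] := by
      have h := isRsopPart_comp_of_rsop hd u hu ![ℓ, j] (by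
        intro x y hxy
        fin_cases x <;> fin_cases y
        · rfl
        · exact absurd hxy.symm hjℓ
        · exact absurd hxy hjℓ
        · rfl)
      have heq : u ∘ ![ℓ, j] = ![u ℓ, u j] := by ext i; fin_cases i <;> rfl
      rwa [heq] at h
    have hπ : Prime (mk (u j)) := prime_mk_of_isRsopPart htwo
    -- the other factors are prime to `ū_j`
    set Q : A ⧸ I := ∏ i ∈ Finset.univ.erase j, mk (u i) ^ a i with hQ
    have hprod : ∏ i, mk (u i) ^ a i = mk (u j) ^ a j * Q :=
      (Finset.mul_prod_erase Finset.univ (fun i => mk (u i) ^ a i) (Finset.mem_univ j)).symm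
    have hQ' : ¬ mk (u j) ∣ Q := by
      rw [hQ, hπ.dvd_finsetProd_iff]
      rintro ⟨i, hi, hdvd⟩
      have hij : i ≠ j := (Finset.mem_erase.mp hi).1
      by_cases hiℓ : i = ℓ
      · subst hiℓ
        rw [haℓ, pow_zero] at hdvd
        exact hπ.not_unit (isUnit_of_dvd_one hdvd)
      · have h1 : mk (u j) ∣ mk (u i) := hπ.dvd_of_dvd_pow hdvd
        have h2 : mk (u i) ∈ (Ideal.span {u j}).map mk := by
          rw [Ideal.map_span, Set.image_singleton]
          exact Ideal.mem_span_singleton.mpr h1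
        rw [hmk, Ideal.mem_quotient_iff_mem_sup, hI, ← Ideal.span_insert] at h2
        refine hfull.not_mem_span_image (S := {j, ℓ}) (i := i) ?_ ?_
        · simp only [Set.mem_insert_iff, Set.mem_singleton_iff, not_or]
          exact ⟨hij, hiℓ⟩
        · rwa [Set.image_pair]
    -- factor out `ū_j` from `ē` and `c̄`
    obtain ⟨δ, e', he', hee'⟩ := WfDvdMonoid.max_power_factor' he0 hπ.not_unit
    have hX : ¬ mk (u j) ∣ e' ^ p * mk w * Q := by
      intro h
      rcases hπ.dvd_or_dvd h with h | h
      · rcases hπ.dvd_or_dvd h with h | h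
        · exact he' (hπ.dvd_of_dvd_pow h)
        · exact hπ.not_unit (isUnit_of_dvd_unit h hwu)
      · exact hQ' h
    have hc0 : mk c ≠ 0 := by
      intro h0
      rw [h0, zero_pow hp.ne_zero, hprod, hee'] at hrel
      have h1 : mk (u j) ^ (p * δ + a j) * (e' ^ p * mk w * Q) = 0 := by
        rw [← hrel]; ring
      rcases mul_eq_zero.mp h1 with h2 | h2
      · exact pow_ne_zero _ hπ.ne_zero h2
      · exact hX (h2 ▸ dvd_zero _)
    obtain ⟨γ, c', hc', hcc'⟩ := WfDvdMonoid.max_power_factor' hc0 hπ.not_unit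
    have hY : ¬ mk (u j) ∣ c' ^ p := fun h => hc' (hπ.dvd_of_dvd_pow h)
    have key : mk (u j) ^ (p * δ + a j) * (e' ^ p * mk w * Q) = mk (u j) ^ (p * γ) * c' ^ p := by
      rw [hprod, hee', hcc'] at hrel
      calc mk (u j) ^ (p * δ + a j) * (e' ^ p * mk w * Q)
          = (mk (u j) ^ δ * e') ^ p * (mk w * (mk (u j) ^ a j * Q)) := by ring
        _ = (mk (u j) ^ γ * c') ^ p := hrel
        _ = mk (u j) ^ (p * γ) * c' ^ p := by ring
    have hexp : p * δ + a j = p * γ := eq_of_pow_mul_eq_pow_mul hπ hX hY key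
    refine hpa ?_
    have h1 : a j = p * γ - p * δ := by omega
    rw [h1]
    exact Nat.dvd_sub (dvd_mul_right p γ) (dvd_mul_right p δ)
  · -- CASE 2: no charged coordinate; `B = A/(u_ℓ)` is regular, hence integrally closed
    push Not at hch
    have hone' : ∏ i, u i ^ a i = 1 := Finset.prod_eq_one fun i _ => by rw [hch i, pow_zero]
    rw [hone', mul_one] at hmem
    have hrange : Set.range ![u ℓ] = {u ℓ} := by
      ext x
      simp only [Set.mem_range, Set.mem_singleton_iff]
      exact ⟨fun ⟨i, hi⟩ => by fin_cases i; exact hi.symm, fun h => ⟨0, h.symm⟩⟩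
    haveI hregB : IsRegularLocalRing (A ⧸ I) := by
      have h := hone.isRegularLocalRing_quotient
      rw [hrange] at h
      exact h
    haveI : IsIntegrallyClosed (A ⧸ I) := isIntegrallyClosed_of_isRegularLocalRing (A ⧸ I)
    -- `ē^p w̄ = c̄^p`, so `ē ∣ c̄` and `w̄ = z̄^p`
    have hrel' : mk e ^ p * mk w = mk c ^ p := by
      have h1 : mk (e ^ p * w - c ^ p) = 0 := (Ideal.Quotient.eq_zero_iff_mem).mpr hmem
      rwa [map_sub, sub_eq_zero, map_mul, map_pow, map_pow] at h1
    have hdvd : mk e ∣ mk c := by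
      rw [← IsIntegrallyClosed.pow_dvd_pow_iff hp.ne_zero]
      exact ⟨mk w, hrel'.symm⟩
    obtain ⟨zbar, hz⟩ := hdvd
    obtain ⟨z, rfl⟩ := Ideal.Quotient.mk_surjective zbar
    have hwz : w - z ^ p ∈ I := by
      rw [← Ideal.Quotient.eq_zero_iff_mem, map_sub, map_pow, sub_eq_zero]
      have h1 : mk e ^ p * mk w = mk e ^ p * mk z ^ p := by rw [hrel', hz, mul_pow]
      exact mul_left_cancel₀ (pow_ne_zero p he0) h1
    rcases reg hch with hwound | ⟨z₀, hz₀, hz₀'⟩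
    · exact hwound z (hIle hwz)
    · apply hz₀'
      have h1 : z ^ p - z₀ ^ p ∈ maximalIdeal A := by
        have h2 : z ^ p - z₀ ^ p = (w - z₀ ^ p) - (w - z ^ p) := by ring
        rw [h2]
        exact sub_mem hz₀ (hIle hwz)
      have h2 : z - z₀ ∈ maximalIdeal A := by
        rw [← sub_pow_char z z₀] at h1
        exact (maximalIdeal.isMaximal A).isPrime.mem_of_pow_mem p h1
      have h3 : z ^ p - z₀ ^ p ∈ maximalIdeal A ^ 2 := by
        rw [← sub_pow_char z z₀]
        exact Ideal.pow_le_pow_right hp.two_le (Ideal.pow_mem_pow h2 p)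
      have h4 : w - z₀ ^ p = (w - z ^ p) + (z ^ p - z₀ ^ p) := by ring
      rw [h4]
      refine add_mem (Ideal.mem_sup_right ?_) (Ideal.mem_sup_left h3)
      refine Ideal.span_mono ?_ hwz
      rintro _ rfl
      exact ⟨ℓ, hℓ, rfl⟩

end Literature.AlgebraicGeometry.Resolution

end
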